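import Literature.MathematicalPhysics.QuantumLattice.HubbardTorusTTPrimeClusterEnergyRepresentative
import Literature.MathematicalPhysics.QuantumLattice.HubbardTorusMarkovRectWindow
import HarnessLib

/-!
# The certified Markov upper bound on the pressure of the `t–t'` Hubbard torus with a weighted-cluster
# (nearest- and next-nearest-neighbour bond) energy representative, and the certified upper edge of the
# thermal energy window at `t' ≠ 0` from 2-row shields

Topic `MathematicalPhysics/QuantumLattice`, namespace `Literature.MathematicalPhysics.QuantumLattice`.

`HubbardTorusMarkovPressureClusterBound.lean` / `HubbardTorusMarkovClusterPressureTorusLimit.lean` /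
`HubbardTorusMarkovRectWindow.lean` read the free-energy certificates C1 of the `hubbard-thermal` programme
on 2-row shields at `t' = 0`. With the `t–t'` energy identity of
`HubbardTorusTTPrimeClusterEnergyRepresentative.lean` (diagonal bonds inside the `2 × 2` corner block) the same
chain runs at `t' ≠ 0` — the cuprate parameter box `t' = −0.25 ± 0.05`:

* §1 `hubbardTTPrime_log_partitionFn_le_of_clusterCertificateTT'` (finite volume, `L ≥ 3`): for
  `K_L = H^{tt'}_L − μ N_L`, a window `Λ ⊆ [0,ℓ)²` with lexicographically largest site `a`, NORMALISED weights
  `(J, J', V, μ')`, a Hermitian `G ∈ 𝔄_Λ` of zero window expectation and a certificate `(L_B, c)`: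
  `log Z_β(K_L) ≤ L² c + (L² − (L+1−ℓ)²)(log 4 − c − β Re tr(ρ_Λ (h + G)))`; annihilator and corner forms;
* §2 `eventually_log_partitionFn_sectorHamiltonianTT'_le_of_clusterCertificateTT'` — the eventual per-volume
  bound on the canonical pressure `(c − β_h μ n + ε) L²` (via the linear-bound lemma of
  `HubbardTorusMarkovClusterPressureTorusLimit.lean`);
* §3 HEADLINES for every torus limit `ω` of the canonical sector Gibbs states at `β` (`U ≥ 0`, `0 ≤ n < 2`),
  `0 < β_h < β`, a `T = 0` row `e(t,t',U,n) ≤ e⁺` and a `t–t'` cluster / corner / RECTANGLE certificate at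
  `(β_h, μ)`: `e_Φ(ω) ≤ (c − β_h μ n + β e⁺)/(β − β_h)` (`…le_of_clusterMarkovCertificateTT'`,
  `…le_of_rectMarkovCertificateTT'`).

[cite: PoulinHastings2011, eqs. (3)–(8)] [cite: XuEtAl2024, eq. (1)] [cite: GustafsonSigal2003, §18.3 Theorem 18.10].
Everything is PROVED; no definition, no named fact.
-/

noncomputable section

namespace Literature.MathematicalPhysics.QuantumLattice

open Matrix Finset HubbardWave0 Literature.Probability.LatticeModels ThermodynamicLimit AndersonCluster
open _root_.Filter
open scoped _root_.Topology ComplexOrder MatrixOrder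

/-! ### §1. Finite volume: the `t–t'` cluster certificate -/

section Torus

variable {L : ℕ} [NeZero L]

/-- (Local, as in `HubbardTorusMarkovPressureBound.lean`.) Orbital equality on the torus is decided through the
linear order. [folklore] -/
local instance (priority := high) instDecidableEqOrbFermionTorusTTMarkov : DecidableEq (Orb (FermionTorus 2 L)) :=
  LinearOrder.toDecidableEq

omit [NeZero L] in
/-- `H^{tt'}_L − μ N_L` is Hermitian (local copy of the lemma of `HubbardTTPrimeTorusFreeEnergyConcavity.lean`,
whose statement carries another decidability instance). [cite: XuEtAl2024, eq. (1)] -/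
private theorem isHermitian_hubbardTorusTT'_sub_mu' (t t' U μ : ℝ) :
    (hubbardTorusTT' L t t' U - (μ : ℂ) • totalNumber).IsHermitian := by
  refine (hubbardTorusTT'_isHermitian L t t' U).sub ?_
  change ((μ : ℂ) • totalNumber)ᴴ = (μ : ℂ) • totalNumber
  have hN : (totalNumber : Matrix (Finset (Orb (FermionTorus 2 L))) (Finset (Orb (FermionTorus 2 L))) ℂ)ᴴ =
      totalNumber := by
    rw [totalNumber_eq_diagonal_card, Matrix.diagonal_conjTranspose]
    congr 1
    funext s
    simp
  rw [Matrix.conjTranspose_smul, Complex.star_def, Complex.conj_ofReal, hN]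

omit [NeZero L] in
/-- `H^{tt'}_L − μ N_L` is even. [cite: ArakiMoriya2003, §4.1 Def. 4.2] -/
theorem parityAut_hubbardTorusTT'_sub_mu (t t' U μ : ℝ) :
    parityAut (hubbardTorusTT' L t t' U - (μ : ℂ) • totalNumber) = hubbardTorusTT' L t t' U - (μ : ℂ) • totalNumber := by
  have hHs : PreservesSectors (hubbardTorusTT' L t t' U) :=
    LiebTwoHoppings.preservesSectors_hamiltonian₂ (fermionTorusGraph 2 L) (fermionTorusDiagGraph L) t t' U
  rw [map_sub, map_smul, parityAut_totalNumber, parityAut_eq_self_of_preservesSectors hHs]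

/-- `H^{tt'}_L − μ N_L` is translation invariant. [cite: XuEtAl2024, eq. (1)] -/
theorem relabel_translate_hubbardTorusTT'_sub_mu (t t' U μ : ℝ) (w : TorusSite 2 L) :
    relabel (Orb.translate w) (hubbardTorusTT' L t t' U - (μ : ℂ) • totalNumber) =
      hubbardTorusTT' L t t' U - (μ : ℂ) • totalNumber := by
  rw [relabel_sub, relabel_smul, relabel_translate_hubbardTorusTT', Orb.translate, relabel_mapEquiv_totalNumber]

/-- **Certified Markov upper bound on the grand-canonical pressure of the `t–t'` Hubbard torus, weighted-
cluster form** (`L ≥ 3`): for `K_L = H^{tt'}_L − μ N_L`, a window `Λ ⊆ [0,ℓ)²` with lexicographically largest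
site `a`, normalised weights (`Σ J̃(·,i) = 1`, `Σ J̃'(·,s) = 1`, `Σ V = 1`, `Σ μ' = −μ`), a Hermitian `G ∈ 𝔄_Λ`
of zero window expectation and a dual certificate `(L_B, c)` for `h = β (h(J,J',V,μ') + G)`:
`log Z_β(K_L) ≤ L² c + (L² − (L+1−ℓ)²)(log 4 − c − β Re tr(ρ_Λ (h(J,J',V,μ') + G)))`.
[cite: PoulinHastings2011, eqs. (3)–(8)] [cite: XuEtAl2024, eq. (1)] -/
theorem hubbardTTPrime_log_partitionFn_le_of_clusterCertificateTT' (t t' U μ β : ℝ) (hL : 3 ≤ L)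
    {Λ : Finset (Site 2)} {a : Site 2} (ha : a ∈ Λ) (hmax : ∀ y ∈ Λ, toLex y ≤ toLex a)
    {ℓ : ℕ} (hΛ : Λ ⊆ halfOpenBox 2 ℓ) (hℓL : ℓ ≤ L)
    {J J' : Site 2 → Fin 2 → ℝ} {V μ' : Site 2 → ℝ}
    (hJ : ∀ i, bondWeightSum Λ J i = 1) (hJ' : ∀ s, diagBondWeightSum Λ J' s = 1)
    (hV : siteWeightSum Λ V = 1) (hμ : siteWeightSum Λ μ' = -μ)
    {G : FermionOp Λ} (hG : G.IsHermitian)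
    (hG0 : (fermionPartialTrace (PolySite.toTorusEmb L (injOn_proj_of_subset_halfOpenBox' hΛ hℓL))
      ((partitionFn β (hubbardTorusTT' L t t' U - (μ : ℂ) • totalNumber))⁻¹ •
        gibbsWeight β (hubbardTorusTT' L t t' U - (μ : ℂ) • totalNumber)) * G).trace = 0)
    {LB : FermionOp (Λ.erase a)} (hLB : LB.IsHermitian) {c : ℝ}
    (hcert : ((Real.exp c : ℂ) • cfc Real.exp LB -
      fermionPartialTrace (PolySite.incl (Finset.erase_subset a Λ))
        (cfc Real.exp (-((β : ℂ) • (clusterHamiltonianTT' Λ t t' U J J' V μ' + G)) +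
          fermionEmbed (PolySite.incl (Finset.erase_subset a Λ)) LB))).PosSemidef) :
    Real.log (partitionFn β (hubbardTorusTT' L t t' U - (μ : ℂ) • totalNumber)).re ≤
      ((L : ℝ) ^ 2) * c +
        (((L ^ 2 : ℕ) : ℝ) - (((L + 1 - ℓ) ^ 2 : ℕ) : ℝ)) *
          (Real.log 4 - c - β *
            (fermionPartialTrace (PolySite.toTorusEmb L (injOn_proj_of_subset_halfOpenBox' hΛ hℓL))
                ((partitionFn β (hubbardTorusTT' L t t' U - (μ : ℂ) • totalNumber))⁻¹ •
                  gibbsWeight β (hubbardTorusTT' L t t' U - (μ : ℂ) • totalNumber)) *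
              (clusterHamiltonianTT' Λ t t' U J J' V μ' + G)).trace.re) := by
  set K : Matrix (Finset (Orb (FermionTorus 2 L))) (Finset (Orb (FermionTorus 2 L))) ℂ :=
    hubbardTorusTT' L t t' U - (μ : ℂ) • totalNumber with hK
  set h : FermionOp Λ := clusterHamiltonianTT' Λ t t' U J J' V μ' + G with hh
  have hKherm : K.IsHermitian := isHermitian_hubbardTorusTT'_sub_mu' t t' U μ
  have hKev : parityAut K = K := parityAut_hubbardTorusTT'_sub_mu t t' U μ
  have hKTI : ∀ w : TorusSite 2 L, relabel (Orb.translate w) K = K := relabel_translate_hubbardTorusTT'_sub_mu t t' U μ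
  have hΩ := injOn_proj_of_subset_halfOpenBox' hΛ hℓL
  set ρ := (partitionFn β K)⁻¹ • gibbsWeight β K with hρdef
  have hρTI : ∀ w : TorusSite 2 L, relabel (Orb.translate w) ρ = ρ := relabel_translate_gibbsDensity L hKTI β
  have hhherm : h.IsHermitian := (isHermitian_clusterHamiltonianTT' Λ t t' U J J' V μ').add hG
  have hKh : (ρ * K).trace.re =
      ((L : ℝ) ^ 2) * (fermionPartialTrace (PolySite.toTorusEmb L hΩ) ρ * h).trace.re := by
    have : (ρ * K).trace = ((L : ℂ) ^ 2) * (fermionPartialTrace (PolySite.toTorusEmb L hΩ) ρ * h).trace := by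
      rw [hK, trace_mul_hubbardTorusTT'_sub_eq_cluster hL t t' U μ hρTI hΩ hJ hJ' hV hμ, hh, Matrix.mul_add,
        Matrix.trace_add, hG0, add_zero]
    rw [this, Complex.mul_re, ← Complex.ofReal_natCast, ← Complex.ofReal_pow, Complex.ofReal_re, Complex.ofReal_im,
      zero_mul, sub_zero]
  exact torus_log_partitionFn_le_of_certificate L hKherm hKev hKTI β ha hmax hΛ hℓL hhherm hKh hLB hcert

end Torus

/-! ### §2. The eventual per-volume bound on the canonical pressure -/

section TorusLimit

/-- (Local.) As in §1. [folklore] -/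
local instance (priority := high) instDecidableEqOrbFermionTorusTTMarkovTL (L : ℕ) :
    DecidableEq (Orb (FermionTorus 2 L)) :=
  LinearOrder.toDecidableEq

/-- **Eventual per-volume bound on the canonical pressure from a `t–t'` weighted-cluster Markov
certificate.** Window `Λ ⊆ [0,ℓ_w)²` with lexicographically largest site `a`, normalised weights
`(J, J', V, μ')`, a Hermitian `G ∈ 𝔄_Λ` with zero expectation in the window marginal of the grand-canonical
Gibbs density for every torus side `L ≥ 3, ℓ_w`, and a dual `(L_B, c)` passing the certificate; then for every
`ε > 0`, eventually `log Z_{β_h}(sectorHamiltonianTT' t t' U n (Ls j)) ≤ (c − β_h μ n + ε)(Ls j)²`.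
[cite: PoulinHastings2011, eqs. (3)–(8)] [cite: Ruelle1969, §3.4] -/
theorem eventually_log_partitionFn_sectorHamiltonianTT'_le_of_clusterCertificateTT' (t t' U μ βh : ℝ)
    {n : ℝ} (hn0 : 0 ≤ n) (hn2 : n ≤ 2) {Ls : ℕ → ℕ} (hLs : Tendsto Ls atTop atTop)
    {Λ : Finset (Site 2)} {a : Site 2} (ha : a ∈ Λ) (hmax : ∀ y ∈ Λ, toLex y ≤ toLex a)
    {ℓw : ℕ} (hΛ : Λ ⊆ halfOpenBox 2 ℓw)
    {J J' : Site 2 → Fin 2 → ℝ} {V μ' : Site 2 → ℝ}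
    (hJ : ∀ i, bondWeightSum Λ J i = 1) (hJ' : ∀ s, diagBondWeightSum Λ J' s = 1)
    (hV : siteWeightSum Λ V = 1) (hμ : siteWeightSum Λ μ' = -μ)
    {G : FermionOp Λ} (hG : G.IsHermitian)
    (hG0 : ∀ (L : ℕ) [NeZero L], 3 ≤ L → ∀ hℓL : ℓw ≤ L,
      (fermionPartialTrace (PolySite.toTorusEmb L (injOn_proj_of_subset_halfOpenBox' hΛ hℓL))
        ((partitionFn βh (hubbardTorusTT' L t t' U - (μ : ℂ) • totalNumber))⁻¹ •
          gibbsWeight βh (hubbardTorusTT' L t t' U - (μ : ℂ) • totalNumber)) * G).trace = 0)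
    {LB : FermionOp (Λ.erase a)} (hLB : LB.IsHermitian) {c : ℝ}
    (hcert : ((Real.exp c : ℂ) • cfc Real.exp LB -
      fermionPartialTrace (PolySite.incl (Finset.erase_subset a Λ))
        (cfc Real.exp (-((βh : ℂ) • (clusterHamiltonianTT' Λ t t' U J J' V μ' + G)) +
          fermionEmbed (PolySite.incl (Finset.erase_subset a Λ)) LB))).PosSemidef)
    {ε : ℝ} (hε : 0 < ε) :
    ∀ᶠ j in atTop, Real.log (partitionFn βh (sectorHamiltonianTT' t t' U n (Ls j))).re ≤
      (c - βh * μ * n + ε) * (Ls j : ℝ) ^ 2 := by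
  have hWherm : (clusterHamiltonianTT' Λ t t' U J J' V μ' + G).IsHermitian :=
    (isHermitian_clusterHamiltonianTT' Λ t t' U J J' V μ').add hG
  obtain ⟨E, hE⟩ := exists_abs_re_trace_mul_density_le hWherm
  refine eventually_log_partitionFn_sectorHamiltonianTT'_le_of_linear t t' U μ βh hn0 hn2 hLs
    (c := c) (C := 2 * (ℓw : ℝ) * (Real.log 4 + |c| + |βh| * |E|)) (L₀ := max 3 ℓw) (fun L hL => ?_) hε
  have hL3 : 3 ≤ L := le_of_max_le_left hL
  have hLw : ℓw ≤ L := le_of_max_le_right hL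
  haveI : NeZero L := ⟨by omega⟩
  have hM0 := hubbardTTPrime_log_partitionFn_le_of_clusterCertificateTT' t t' U μ βh hL3 ha hmax hΛ hLw hJ hJ' hV hμ
    hG (hG0 L hL3 hLw) hLB hcert
  set e : ℝ := (fermionPartialTrace (PolySite.toTorusEmb L (injOn_proj_of_subset_halfOpenBox' hΛ hLw))
      ((partitionFn βh (hubbardTorusTT' L t t' U - (μ : ℂ) • totalNumber))⁻¹ •
        gibbsWeight βh (hubbardTorusTT' L t t' U - (μ : ℂ) • totalNumber)) *
      (clusterHamiltonianTT' Λ t t' U J J' V μ' + G)).trace.re with hedef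
  have heE : |e| ≤ E := by
    rw [hedef]
    haveI : Nonempty (Finset (Orb (FermionTorus 2 L))) := ⟨∅⟩
    have hK := isHermitian_hubbardTorusTT'_sub_mu' (L := L) t t' U μ
    refine hE _ (posSemidef_fermionPartialTrace _ (hK.posSemidef_gibbsDensity βh)) ?_
    rw [trace_fermionPartialTrace, trace_gibbsDensity _ _ (partitionFn_pos βh hK).ne']
  have hℓw : 1 ≤ ℓw := by
    have := mem_halfOpenBox.1 (hΛ ha) 0
    omega
  have hsub : ((L + 1 - ℓw : ℕ) : ℝ) = (L : ℝ) + 1 - (ℓw : ℝ) := by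
    rw [Nat.cast_sub (by omega)]
    push_cast
    ring
  have hℓr : (1 : ℝ) ≤ (ℓw : ℝ) := by exact_mod_cast hℓw
  have hLr : (ℓw : ℝ) ≤ (L : ℝ) := by exact_mod_cast hLw
  have hN1 : ((L ^ 2 : ℕ) : ℝ) - (((L + 1 - ℓw) ^ 2 : ℕ) : ℝ) ≤ 2 * (ℓw : ℝ) * (L : ℝ) := by
    push_cast
    rw [hsub]
    nlinarith
  have hN0 : 0 ≤ ((L ^ 2 : ℕ) : ℝ) - (((L + 1 - ℓw) ^ 2 : ℕ) : ℝ) := by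
    push_cast
    rw [hsub]
    nlinarith
  have hfac : Real.log 4 - c - βh * e ≤ Real.log 4 + |c| + |βh| * |E| := by
    have h2 : -(βh * e) ≤ |βh| * |E| := (neg_le_abs _).trans
      ((abs_mul βh e).le.trans (mul_le_mul_of_nonneg_left (heE.trans (le_abs_self E)) (abs_nonneg _)))
    linarith [neg_le_abs c]
  have hlog4 : 0 ≤ Real.log 4 := Real.log_nonneg (by norm_num)
  have hbd : (((L ^ 2 : ℕ) : ℝ) - (((L + 1 - ℓw) ^ 2 : ℕ) : ℝ)) * (Real.log 4 - c - βh * e) ≤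
      2 * (ℓw : ℝ) * (L : ℝ) * (Real.log 4 + |c| + |βh| * |E|) :=
    (mul_le_mul_of_nonneg_left hfac hN0).trans (mul_le_mul_of_nonneg_right hN1 (by positivity))
  have hM' : Real.log (partitionFn βh (hubbardTorusTT' L t t' U - (μ : ℂ) • totalNumber)).re ≤
      ((L : ℝ) ^ 2) * c + (((L ^ 2 : ℕ) : ℝ) - (((L + 1 - ℓw) ^ 2 : ℕ) : ℝ)) * (Real.log 4 - c - βh * e) := by
    rw [hedef]
    exact hM0
  nlinarith [hM', hbd]

/-! ### §3. Headlines: the certified upper edge at `t' ≠ 0` -/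

namespace InfVolFermionState

variable {t t' U n β : ℝ} {ω : InfVolFermionState 2} {Ls : ℕ → ℕ}

/-- **Certified upper edge from a `t–t'` weighted-cluster Markov certificate with a structured annihilator and
a `T = 0` row.** For every torus limit `ω` of the canonical sector Gibbs states of the `t–t'` Hubbard model
(`U ≥ 0`, `0 ≤ n < 2`) at `β` along `Ls → ∞`, `0 < β_h < β`, a certificate `(Λ, a, J, J', V, μ', G, L_B, c)` at
`(β_h, μ)` with `G = windowAnnihilator …`, and a row `e(t,t',U,n) ≤ e⁺`:
`e_Φ(ω) ≤ (c − β_h μ n + β e⁺)/(β − β_h)`. [cite: PoulinHastings2011, eqs. (3)–(8)]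
[cite: GustafsonSigal2003, §18.3 Theorem 18.10] -/
theorem IsTorusLimitOfMixture.meanEnergy_hubbardTTPrime_le_of_clusterMarkovCertificateTT'
    (hU : 0 ≤ U) (hn0 : 0 ≤ n) (hn2 : n < 2)
    (h : ω.IsTorusLimitOfMixture (sectorGibbsCount n) (fun L => sectorGibbsWeightTT' β t t' U n L)
      (fun L => sectorGibbsVectorTT' t t' U n L) Ls)
    (hLs : Tendsto Ls atTop atTop) {βh : ℝ} (hβh : 0 < βh) (hlt : βh < β)
    (μ : ℝ) {Λ : Finset (Site 2)} {a : Site 2} (ha : a ∈ Λ) (hmax : ∀ y ∈ Λ, toLex y ≤ toLex a)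
    {ℓw : ℕ} (hΛ : Λ ⊆ halfOpenBox 2 ℓw)
    {J J' : Site 2 → Fin 2 → ℝ} {V μ' : Site 2 → ℝ}
    (hJ : ∀ i, bondWeightSum Λ J i = 1) (hJ' : ∀ s, diagBondWeightSum Λ J' s = 1)
    (hV : siteWeightSum Λ V = 1) (hμ : siteWeightSum Λ μ' = -μ)
    {ι : Type*} (s : Finset ι) (S : ι → Finset (Site 2)) (hS : ∀ i, S i ⊆ Λ) (z : ι → Site 2)
    (hz : ∀ i, shiftSet (z i) (S i) ⊆ Λ) {O : ∀ i, FermionOp (S i)} (hO : ∀ i ∈ s, (O i).IsHermitian)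
    (g : ι → ℝ)
    {LB : FermionOp (Λ.erase a)} (hLB : LB.IsHermitian) {c : ℝ}
    (hcert : ((Real.exp c : ℂ) • cfc Real.exp LB -
      fermionPartialTrace (PolySite.incl (Finset.erase_subset a Λ))
        (cfc Real.exp (-((βh : ℂ) • (clusterHamiltonianTT' Λ t t' U J J' V μ' + windowAnnihilator s Λ S hS z hz O g)) +
          fermionEmbed (PolySite.incl (Finset.erase_subset a Λ)) LB))).PosSemidef)
    {eup : ℝ} (he : energyDensityTT' t t' U n ≤ eup) :
    ω.meanEnergy (hubbardTTPrimeFermionInteraction t t' U) 1 ≤ (c - βh * μ * n + β * eup) / (β - βh) := by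
  refine h.meanEnergy_hubbardTTPrime_le_of_eventually_hot_of_energyDensityTT'_le hU hn0 hn2 hLs hβh hlt
    (fun _ hε => eventually_log_partitionFn_sectorHamiltonianTT'_le_of_clusterCertificateTT' t t' U μ βh hn0 hn2.le
      hLs ha hmax hΛ hJ hJ' hV hμ (isHermitian_windowAnnihilator s Λ S hS z hz hO g) (fun L _ hL3 hℓL => ?_) hLB
      hcert hε) he
  exact trace_window_mul_windowAnnihilator
    (relabel_translate_gibbsDensity L (relabel_translate_hubbardTorusTT'_sub_mu (L := L) t t' U μ) βh)
    _ s S hS z hz O g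

/-- The far corner `(a−2, b−2) = (a−1, b−1) − e₀ − e₁` of the `2 × 2` corner block lies in the rectangle
(`a, b ≥ 2`). [cite: Anderson1951, eq. (2)] -/
theorem rectCorner_sub_unitVec_sub_unitVec_mem_rectWindow {a b : ℕ} (ha : 2 ≤ a) (hb : 2 ≤ b) :
    mkSite2 (a - 1) (b - 1) - unitVec 0 - unitVec 1 ∈ rectWindow a b := by
  rw [rectCorner_sub_unitVec_zero a b ha]
  have h : mkSite2 (a - 2) (b - 1) - unitVec (1 : Fin 2) = mkSite2 (a - 2) (b - 2) := by
    have := rectCorner_sub_unitVec_one (a - 1) b hb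
    rw [show a - 1 - 1 = a - 2 by omega] at this
    exact this
  rw [h]
  exact mkSite2_mem_rectWindow (by omega) (by omega)

/-- **Certified upper edge of the thermal energy window from a `t–t'` C1 certificate on an `a × b` rectangle**
(corner representative `cornerEnergyRepTT'` with the diagonal bonds of the corner block, structured annihilator,
dual `L_B`, constant `c`; `a, b ≥ 2`) and a `T = 0` row `e(t,t',U,n) ≤ e⁺`: for every torus limit `ω` of the
canonical sector Gibbs states (`U ≥ 0`, `0 ≤ n < 2`) at `β > β_h > 0`:
`e_Φ(ω) ≤ (c − β_h μ n + β e⁺)/(β − β_h)`. [cite: PoulinHastings2011, eqs. (3)–(8)]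
[cite: GustafsonSigal2003, §18.3 Theorem 18.10] [cite: XuEtAl2024, eq. (1)] -/
theorem IsTorusLimitOfMixture.meanEnergy_hubbardTTPrime_le_of_rectMarkovCertificateTT'
    (hU : 0 ≤ U) (hn0 : 0 ≤ n) (hn2 : n < 2)
    (h : ω.IsTorusLimitOfMixture (sectorGibbsCount n) (fun L => sectorGibbsWeightTT' β t t' U n L)
      (fun L => sectorGibbsVectorTT' t t' U n L) Ls)
    (hLs : Tendsto Ls atTop atTop) {βh : ℝ} (hβh : 0 < βh) (hlt : βh < β) (μ : ℝ)
    {a b : ℕ} (ha : 2 ≤ a) (hb : 2 ≤ b)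
    {ι : Type*} (s : Finset ι) (S : ι → Finset (Site 2)) (hS : ∀ i, S i ⊆ rectWindow a b) (z : ι → Site 2)
    (hz : ∀ i, shiftSet (z i) (S i) ⊆ rectWindow a b) {O : ∀ i, FermionOp (S i)}
    (hO : ∀ i ∈ s, (O i).IsHermitian) (g : ι → ℝ)
    {LB : FermionOp ((rectWindow a b).erase (mkSite2 (a - 1) (b - 1)))} (hLB : LB.IsHermitian) {c : ℝ}
    (hcert : ((Real.exp c : ℂ) • cfc Real.exp LB -
      fermionPartialTrace (PolySite.incl (Finset.erase_subset (mkSite2 (a - 1) (b - 1)) (rectWindow a b)))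
        (cfc Real.exp (-((βh : ℂ) • (cornerEnergyRepTT' (rectWindow a b) (mkSite2 (a - 1) (b - 1)) t t' U μ +
            windowAnnihilator s (rectWindow a b) S hS z hz O g)) +
          fermionEmbed (PolySite.incl (Finset.erase_subset (mkSite2 (a - 1) (b - 1)) (rectWindow a b))) LB))).PosSemidef)
    {eup : ℝ} (he : energyDensityTT' t t' U n ≤ eup) :
    ω.meanEnergy (hubbardTTPrimeFermionInteraction t t' U) 1 ≤ (c - βh * μ * n + β * eup) / (β - βh) := by
  have hA := rectCorner_mem_rectWindow (a := a) (b := b) (by omega) (by omega)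
  exact h.meanEnergy_hubbardTTPrime_le_of_clusterMarkovCertificateTT' hU hn0 hn2 hLs hβh hlt μ hA
    toLex_le_toLex_rectCorner (rectWindow_subset_halfOpenBox_max a b)
    (fun i => bondWeightSum_cornerBondWeight hA (rectCorner_sub_unitVec_mem_rectWindow ha hb i))
    (diagBondWeightSum_cornerDiagBondWeight hA (rectCorner_sub_unitVec_mem_rectWindow ha hb 0)
      (rectCorner_sub_unitVec_mem_rectWindow ha hb 1) (rectCorner_sub_unitVec_sub_unitVec_mem_rectWindow ha hb))
    (siteWeightSum_cornerSiteWeight hA) (siteWeightSum_mul_cornerSiteWeight hA (-μ)) s S hS z hz hO g hLB hcert he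

end InfVolFermionState

end TorusLimit

end Literature.MathematicalPhysics.QuantumLattice

end
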